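import Literature.Analysis.FluidPDE.TaoQuantitativeSupBound
import Literature.Analysis.FluidPDE.KNSSProp41OfLocal
import Literature.Analysis.FluidPDE.KNSSLocalSmoothingHolds
import Literature.Analysis.FluidPDE.NSBoundedMildSmoothing
import HarnessLib

/-!
# Tao 2021, Prop. 3.1 (iii), step 7: higher regularity on an epoch via the KNSS smoothing theory

Analysis/FluidPDE proof file (theorems only, no named facts), step 7g of the inline programme
for `Literature.Analysis.FluidPDE.tao_quantitative_ess` (Tao 2021, Thm. 1.2).

T. Tao, arXiv:1908.04958v2, proof of Prop. 3.1 (iii), pp. 14–15: once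
(3.24) `‖u‖_{L^∞_tL^∞_x([τ(0.2),τ(1)]×ℝ³)} ≲ A^{O(1)}` is available, "These are subcritical regularity
estimates and can now be iterated to obtain even higher regularity" — the differentiated Duhamel
formula gives `‖∇u‖_{L^∞} ≲ A^{O(1)}`, and "Standard parabolic regularity estimates (see e.g.,
[LSU]) then give `‖∇ω‖_{L^∞} ≲ A^{O(1)}`". For this quantitative smoothing of a bounded mild
solution the tree has Koch–Nadirashvili–Seregin–Šverák's Proposition 4.1 with (4.6), PROVED
(`KNSS2009_prop41_mild_of_local knss2009_local_smoothing_holds`): a restarted bounded mild field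
`V` (`IsKNSSDriftMild T N V 0`) has `(t − s)^{k/2}‖∇ᵏV(t)‖ ≤ C(k)N` whenever `N²(t − s) < ε(k)`.

This file proves:

* `IsTaoSolutionOn.eq_heatExtension_sub_oseenDuhamel_of_lt` — the mild identity of a Tao-class
  solution restarted at any time `s`, **pointwise**: `u(t) = e^{(t−s)Δ}u(s) − B¹ₛ(u, u)(t)` for
  `0 ≤ s < t ≤ T` (the a.e. identity `ae_eq_heatExtension_sub_oseenDuhamel` for the translate, the
  time translation `oseenDuhamel_translate`, and continuity of both sides,
  `continuous_oseenDuhamel_slice`);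
* `IsTaoSolutionOn.isKNSSDriftMild_clamp` — a Tao-class solution bounded by `N` is a restarted
  bounded mild field in the sense of KNSS (the time-clamped field, `driftDuhamel_zero_eq_oseenDuhamel`);
* `IsTaoSolutionOn.epoch_regularity` — **Prop. 3.1 (iii) in the normalised frame, all orders**:
  absolute `c > 0` and `C(k)` such that every Tao-class solution on `[0, 2]` with `‖u(t)‖₃ ≤ A`
  has an epoch `[t₃, t₃ + c/A⁸] ⊂ [1, 2]` on which `‖∇ᵏu(t, x)‖ ≤ C(k) A^{10(k+1)}` for every `k`
  (`epoch_sup_bound`, the bridge, and KNSS (4.6) on windows of length `min(ℓ/4, ε(k)/(2N²))`).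

## References

* T. Tao, arXiv:1908.04958v2 (2021), Prop. 3.1 (iii), proof pp. 14–15. [Tao2021QuantitativeNS]
* G. Koch, N. Nadirashvili, G. Seregin, V. Šverák, Acta Math. 203 (2009), Prop. 4.1 with (4.6).
  [KochNadirashviliSereginSverak2009]
-/

noncomputable section

open MeasureTheory Set Function Filter Topology
open Literature.Analysis.FunctionSpaces
open scoped ENNReal NNReal RealInnerProductSpace Laplacian ContDiff

namespace Literature.Analysis.FluidPDE

open UnboundedOperators

namespace IsTaoSolutionOn

variable {T : ℝ} {u₀ : EuclideanSpace ℝ (Fin 3) → EuclideanSpace ℝ (Fin 3)}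
  {u : ℝ → EuclideanSpace ℝ (Fin 3) → EuclideanSpace ℝ (Fin 3)}
  {q : ℝ → EuclideanSpace ℝ (Fin 3) → ℝ}

/-! ## The mild identity restarted at `s`, pointwise -/

/-- **The mild identity of a Tao-class solution restarted at any time, pointwise**: for
`0 ≤ s < t ≤ T` and every `x`, `u(t, x) = e^{(t−s)Δ}u(s)(x) − B¹ₛ(u, u)(t)(x)` — the a.e. identity
of the translate (`ae_eq_heatExtension_sub_oseenDuhamel`, `oseenDuhamel_translate`), both sides
being continuous (`continuous_oseenDuhamel_slice` for the bounded, jointly measurable velocity).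
[cite: Tao2021QuantitativeNS, (3.7) p. 10 and (3.23) p. 14] -/
theorem eq_heatExtension_sub_oseenDuhamel_of_lt (h : IsTaoSolutionOn T 1 u₀ u q) {s t : ℝ}
    (hs : 0 ≤ s) (hst : s < t) (htT : t ≤ T) (x : EuclideanSpace ℝ (Fin 3)) :
    u t x = heatExtension (u s) (t - s) x - oseenDuhamel 1 s u u t x := by
  have hsT : s < T := hst.trans_le htT
  have hτ := h.translate hs hsT
  have hae := hτ.ae_eq_heatExtension_sub_oseenDuhamel (sub_pos.2 hsT) (t := t - s)
    ⟨sub_pos.2 hst, by linarith⟩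
  have htr : ∀ y, oseenDuhamel 1 0 (fun r => u (r + s)) (fun r => u (r + s)) (t - s) y =
      oseenDuhamel 1 s u u t y := fun y => by
    rw [oseenDuhamel_translate, zero_add, sub_add_cancel]
  simp only [sub_add_cancel] at hae
  simp_rw [htr] at hae
  -- continuity of both sides
  obtain ⟨B, hB0, hB⟩ := h.exists_bound_velocity
  have hum : AEStronglyMeasurable (uncurry u) (volume.restrict (Ioo s T ×ˢ univ)) :=
    h.aestronglyMeasurable_uncurry.mono_measure
      (Measure.restrict_mono (prod_mono (Ioo_subset_Ioo_left hs) subset_rfl) le_rfl)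
  have hBτ : ∀ τ ∈ Ioo s T, ∀ y, ‖u τ y‖ ≤ B := fun τ hτ y => hB τ ⟨hs.trans hτ.1.le, hτ.2.le⟩ y
  have hBc : Continuous (oseenDuhamel 1 s u u t) :=
    continuous_oseenDuhamel_slice one_pos hB0 hum hum hBτ hBτ hst htT
  have hHc : Continuous (heatExtension (u s) (t - s)) :=
    ((h.isSmoothL2Field_slice ⟨hs, hsT.le⟩).heatExtension (sub_pos.2 hst)).continuous
  have huc : Continuous (u t) := (h.isSmoothL2Field_slice ⟨by linarith, htT⟩).continuous
  have heq := (Continuous.ae_eq_iff_eq volume huc (hHc.sub hBc)).1 hae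
  exact congrFun heq x

/-! ## Tao-class solutions are restarted bounded mild fields (KNSS) -/

/-- **A bounded Tao-class solution is a restarted bounded mild field in the sense of KNSS 2009,
§4 (i)**: if `(u, q)` is Tao-class on `[0, T]` with `‖u‖ ≤ N` on `[0, T] × ℝ³`, the time-clamped
field `V(t) = u(max 0 (min t T))` (jointly continuous, hence measurable, equal to `u` on `(0, T)`)
satisfies `IsKNSSDriftMild T N V 0`: bounded by `N`, weakly divergence free at every time
(`VectorCalculus.IsDivFree.isWeaklyDivFree_holds`), and `V(t) = e^{(t−s)Δ}V(s) − B¹ₛ(V,V)(t)`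
pointwise for `0 < s < t < T` (`eq_heatExtension_sub_oseenDuhamel_of_lt` with
`driftDuhamel_zero_eq_oseenDuhamel`). [cite: KochNadirashviliSereginSverak2009, §4 (i) (arXiv:0709.3599v1 p. 8)] -/
theorem isKNSSDriftMild_clamp (h : IsTaoSolutionOn T 1 u₀ u q) (hT : 0 < T) {N : ℝ}
    (hN : ∀ t ∈ Icc 0 T, ∀ x, ‖u t x‖ ≤ N) :
    IsKNSSDriftMild T N (fun t x => u (max 0 (min t T)) x) 0 := by
  obtain ⟨hκc, hκmem, hκid⟩ := clamp_facts hT.le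
  have hN0 : 0 ≤ N := (norm_nonneg _).trans (hN 0 ⟨le_rfl, hT.le⟩ 0)
  have hcont : Continuous (uncurry fun t x => u (max 0 (min t T)) x) := by
    have hmap : Continuous fun p : ℝ × EuclideanSpace ℝ (Fin 3) => (max 0 (min p.1 T), p.2) :=
      (hκc.comp continuous_fst).prodMk continuous_snd
    have hinto : ∀ p : ℝ × EuclideanSpace ℝ (Fin 3),
        (max 0 (min p.1 T), p.2) ∈ Icc 0 T ×ˢ (univ : Set _) := fun p => ⟨hκmem p.1, mem_univ _⟩
    exact (h.classical.smooth_velocity.continuousOn.comp_continuous hmap hinto).congr fun p => rfl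
  refine IsKNSSDriftMild.mk measurable_const (fun t => by simpa using hN0) hcont.measurable
    (fun t _ x => hN _ (hκmem t) x) ?_ ?_
  · refine (ae_restrict_mem measurableSet_Ioo).mono fun t ht => ?_
    obtain ⟨hsm, hdiv, -⟩ := h.slice (hκmem t)
    exact VectorCalculus.IsDivFree.isWeaklyDivFree_holds hdiv (hsm.of_le (by exact_mod_cast le_top))
  · intro s t hs hst htT x
    have hsid : max 0 (min s T) = s := hκid s ⟨hs.le, (hst.trans htT).le⟩
    have htid : max 0 (min t T) = t := hκid t ⟨(hs.trans hst).le, htT.le⟩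
    have hVm : ∀ σ ∈ Ioo s t, Measurable fun x => u (max 0 (min σ T)) x := fun σ _ =>
      (h.isSmoothL2Field_slice (hκmem σ)).continuous.measurable
    have hVN : ∀ σ ∈ Ioo s t, ∀ y, ‖u (max 0 (min σ T)) y‖ ≤ N := fun σ _ y => hN _ (hκmem σ) y
    rw [driftDuhamel_zero_eq_oseenDuhamel finrank_euclideanSpace_fin hVm hVN hst.le x]
    have hcongr : ∀ τ ∈ Ioo s t, (fun x => u (max 0 (min τ T)) x) = u τ := fun τ hτ => by
      funext y; rw [hκid τ ⟨(hs.trans hτ.1).le, (hτ.2.trans htT).le⟩]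
    rw [oseenDuhamel_congr_Ioo hcongr hcongr x]
    simp only [hsid, htid]
    exact h.eq_heatExtension_sub_oseenDuhamel_of_lt hs.le hst htT.le x

/-! ## Prop. 3.1 (iii), normalised: all derivatives are `A^{O(1)}` on an epoch -/

set_option maxHeartbeats 800000 in
/-- **Tao 2021, Prop. 3.1 (iii) (epochs of regularity), normalised frame, all orders.** There are
an absolute `c > 0` and constants `C(k) ≥ 0` such that for every Tao-class solution `(u, q)` on
`[0, 2]` with `‖u(t)‖₃ ≤ A` on `[0, 2]`, `A ≥ 1`, there is `t₃ ∈ [1, 15/8]` such that for every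
order `k`, `‖∇ᵏu(t, x)‖ ≤ C(k) A^{10(k+1)}` for all `t ∈ [t₃, t₃ + c/A⁸]` and all `x`. In
particular `u, ∇u, ω = curl u, ∇ω` are `O(A^{O(1)})` on an epoch of length `≳ A^{-8}` inside the
unit interval `[1, 2]`, which is (iii) for the interval `I = [1, 2]` with the implied constants
made explicit (Tao's `|I'| ≳ A^{-8}|I|` is kept; the exponents `A^{O(1)}` are `A^{10(k+1)}`).
Proof: the sup bound `‖u‖ ≤ N = CA^{10}` on `[t₂, t₂ + ℓ]`, `ℓ = c/A⁸` (`epoch_sup_bound`); the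
translate is a restarted bounded mild field (`isKNSSDriftMild_clamp`); KNSS (4.6) on the window
`(t − g, t)`, `g = min(ℓ/4, ε(k)/(2N²))`, gives `‖∇ᵏu(t)‖ ≤ C(k) N g^{-k/2}` for
`t ∈ [t₂ + ℓ/2, t₂ + 3ℓ/4]`, and `g^{-1} ≤ (4/c + 2C²/ε(k)) A^{20}`.
[cite: Tao2021QuantitativeNS, Prop. 3.1 (iii) and its proof pp. 13–15] -/
theorem epoch_regularity :
    ∃ c : ℝ, 0 < c ∧ ∃ Ck : ℕ → ℝ, (∀ k, 0 ≤ Ck k) ∧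
      ∀ ⦃u₀ : EuclideanSpace ℝ (Fin 3) → EuclideanSpace ℝ (Fin 3)⦄
        ⦃u : ℝ → EuclideanSpace ℝ (Fin 3) → EuclideanSpace ℝ (Fin 3)⦄
        ⦃q : ℝ → EuclideanSpace ℝ (Fin 3) → ℝ⦄, IsTaoSolutionOn 2 1 u₀ u q →
      ∀ ⦃A : ℝ⦄, 1 ≤ A → (∀ t ∈ Icc (0 : ℝ) 2, eLpNorm (u t) 3 volume ≤ ENNReal.ofReal A) →
      ∃ t₃ ∈ Icc (1 : ℝ) (15 / 8), ∀ k : ℕ, ∀ t ∈ Icc t₃ (t₃ + c / A ^ 8), ∀ x,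
        ‖iteratedFDeriv ℝ k (u t) x‖ ≤ Ck k * A ^ (10 * (k + 1)) := by
  obtain ⟨c, C, hc, hc4, hC, hSup⟩ := epoch_sup_bound
  have h41 := KNSS2009_prop41_mild_of_local (knss2009_local_smoothing_holds _)
  choose ε hε Cp hCp hP using h41
  obtain ⟨γ, hγ⟩ : ∃ γ : ℕ → ℝ, γ = fun k => 4 / c + 2 * C ^ 2 / ε k := ⟨_, rfl⟩
  have hγ0 : ∀ k, 0 < γ k := fun k => by rw [hγ]; have := hε k; positivity
  refine ⟨c / 4, by positivity, fun k => Cp k * C * γ k ^ ((k : ℝ) / 2), fun k => by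
    have := hCp k; have := (hγ0 k).le; positivity, fun u₀ u q h A hA hA3 => ?_⟩
  have hA0 : 0 < A := by linarith
  have hA1 : 0 ≤ A := hA0.le
  have hA8 : 1 ≤ A ^ 8 := one_le_pow₀ hA
  have hA20 : A ^ 8 ≤ A ^ 20 := pow_le_pow_right₀ hA (by norm_num)
  -- the epoch of boundedness
  obtain ⟨t₂, ht₂, hN⟩ := hSup h hA hA3
  obtain ⟨ℓ, hℓdef⟩ : ∃ ℓ : ℝ, ℓ = c / A ^ 8 := ⟨_, rfl⟩
  rw [← hℓdef] at hN
  have hℓ : 0 < ℓ := by rw [hℓdef]; positivity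
  have hℓc : ℓ ≤ c := by rw [hℓdef]; exact div_le_self hc.le hA8
  have hℓ4 : ℓ ≤ 1 / 4 := hℓc.trans hc4
  have ht₂2 : t₂ < 2 := by linarith [ht₂.2]
  obtain ⟨N, hNdef⟩ : ∃ N : ℝ, N = C * A ^ 10 := ⟨_, rfl⟩
  have hNpos : 0 < N := by rw [hNdef]; positivity
  -- the translate to `t₂`, a restarted bounded mild field on `(0, ℓ)`
  have hτ := (h.translate (a := t₂) (by linarith [ht₂.1]) ht₂2).mono hℓ (by linarith [ht₂.2])
  have hbd : ∀ t ∈ Icc 0 ℓ, ∀ x, ‖u (t + t₂) x‖ ≤ N := fun t ht x => by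
    rw [hNdef]; exact hN (t + t₂) ⟨by linarith [ht.1], by linarith [ht.2]⟩ x
  have hK := hτ.isKNSSDriftMild_clamp hℓ hbd
  obtain ⟨hκc, hκmem, hκid⟩ := clamp_facts hℓ.le
  -- the output epoch `[t₂ + ℓ/2, t₂ + 3ℓ/4]`
  refine ⟨t₂ + ℓ / 2, ⟨by linarith [ht₂.1], by linarith [ht₂.2]⟩, fun k t ht x => ?_⟩
  have hℓ' : c / 4 / A ^ 8 = ℓ / 4 := by rw [hℓdef]; ring
  rw [hℓ'] at ht
  obtain ⟨-, hreg⟩ := hP k hK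
  -- the window `(t' - g, t')`
  obtain ⟨g, hgdef⟩ : ∃ g : ℝ, g = min (ℓ / 4) (ε k / (2 * N ^ 2)) := ⟨_, rfl⟩
  have hg : 0 < g := by rw [hgdef]; have := hε k; positivity
  have hgℓ : g ≤ ℓ / 4 := by rw [hgdef]; exact min_le_left _ _
  have hgε : g ≤ ε k / (2 * N ^ 2) := by rw [hgdef]; exact min_le_right _ _
  have ht' : t - t₂ ∈ Icc (ℓ / 2) (3 * ℓ / 4) := ⟨by linarith [ht.1], by linarith [ht.2]⟩
  have hs' : t - t₂ - g ∈ Ioo 0 ℓ := ⟨by linarith [ht'.1], by linarith [ht'.2]⟩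
  have ht'' : t - t₂ ∈ Ioo (t - t₂ - g) ℓ := ⟨by linarith, by linarith [ht'.2]⟩
  have hNε : N ^ 2 * (t - t₂ - (t - t₂ - g)) < ε k := by
    rw [show t - t₂ - (t - t₂ - g) = g by ring]
    have h1 : N ^ 2 * g ≤ N ^ 2 * (ε k / (2 * N ^ 2)) := mul_le_mul_of_nonneg_left hgε (by positivity)
    have h2 : N ^ 2 * (ε k / (2 * N ^ 2)) = ε k / 2 := by field_simp
    linarith [hε k]
  obtain ⟨hb, -⟩ := hreg (t - t₂ - g) hs' (t - t₂) ht'' hNε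
  have hbx := hb x
  rw [show t - t₂ - (t - t₂ - g) = g by ring] at hbx
  -- `V(t - t₂) = u(t)`
  have hV : (fun y => u (max 0 (min (t - t₂) ℓ) + t₂) y) = u t := by
    funext y; rw [hκid (t - t₂) ⟨by linarith [ht'.1], by linarith [ht'.2]⟩, sub_add_cancel]
  rw [hV] at hbx
  -- `‖∇ᵏu(t)‖ ≤ C(k) N g^{-k/2}` and `g^{-1} ≤ γ(k) A^{20}`
  have h1 := le_mul_rpow_neg_of_rpow_mul_le hg hbx
  have hginv : g⁻¹ ≤ γ k * A ^ 20 := by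
    have hℓinv : (ℓ / 4)⁻¹ = 4 / c * A ^ 8 := by rw [hℓdef]; field_simp
    have hεinv : (ε k / (2 * N ^ 2))⁻¹ = 2 * C ^ 2 / ε k * A ^ 20 := by
      rw [hNdef]; field_simp
    have hb1 : 4 / c * A ^ 8 ≤ 4 / c * A ^ 20 := mul_le_mul_of_nonneg_left hA20 (by positivity)
    have hsum : γ k * A ^ 20 = 4 / c * A ^ 20 + 2 * C ^ 2 / ε k * A ^ 20 := by rw [hγ]; ring
    have hp1 : 0 ≤ 4 / c * A ^ 20 := by positivity
    have hp2 : 0 ≤ 2 * C ^ 2 / ε k * A ^ 20 := by have := hε k; positivity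
    rw [hsum, hgdef]
    rcases min_choice (ℓ / 4) (ε k / (2 * N ^ 2)) with hmin | hmin
    · rw [hmin, hℓinv]; linarith
    · rw [hmin, hεinv]; linarith
  have hgpow : g ^ (-((k : ℝ) / 2)) ≤ γ k ^ ((k : ℝ) / 2) * A ^ (10 * k) := by
    rw [Real.rpow_neg hg.le, ← Real.inv_rpow hg.le]
    calc g⁻¹ ^ ((k : ℝ) / 2) ≤ (γ k * A ^ 20) ^ ((k : ℝ) / 2) :=
          Real.rpow_le_rpow (inv_nonneg.2 hg.le) hginv (by positivity)
      _ = γ k ^ ((k : ℝ) / 2) * A ^ (10 * k) := by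
          rw [Real.mul_rpow (hγ0 k).le (by positivity), ← Real.rpow_natCast A 20,
            ← Real.rpow_mul hA1, show ((20 : ℕ) : ℝ) * ((k : ℝ) / 2) = ((10 * k : ℕ) : ℝ) by
              push_cast; ring, Real.rpow_natCast]
  calc ‖iteratedFDeriv ℝ k (u t) x‖ ≤ Cp k * N * g ^ (-((k : ℝ) / 2)) := h1
    _ ≤ Cp k * N * (γ k ^ ((k : ℝ) / 2) * A ^ (10 * k)) :=
        mul_le_mul_of_nonneg_left hgpow (mul_nonneg (hCp k) hNpos.le)
    _ = Cp k * C * γ k ^ ((k : ℝ) / 2) * A ^ (10 * (k + 1)) := by rw [hNdef]; ring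

end IsTaoSolutionOn

end Literature.Analysis.FluidPDE
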